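import Summits.KontsevichZagierPeriods.KontsevichZagierPeriods.Theses.IsogenyCertificates
import Literature.NumberTheory.Transcendental.KZCalculus
import Summits.KontsevichZagierPeriods.KontsevichZagierPeriods.Theorems.IsogenyCertificatesXMapPeriodTransferStubCellMove
import Summits.KontsevichZagierPeriods.KontsevichZagierPeriods.Theorems.IsogenyCertificatesAlgebraicModuliRealPeriodCellPeriodRep

/-!
# `AlgebraicModuliRealPeriodCell` (stmt-KontsevichZagierPeriods-18265, route IsogenyCertificates) —
line `Sketch`, stub T (`stub_algXMapTransfer`), phase 1a (iv): one cell, one move of rule (2)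

Port of the `ℚ`-line's stub file `IsogenyCertificatesXMapPeriodTransferStubCellMove.lean` (crux
`XMapPeriodTransfer`, line `saturated-sign-cells`) to REAL-ALGEBRAIC data. For a real datum
`(f, g, c)` (`f g : ℝ[X]` with algebraic coefficients, `c : ℝ`) between `y² = P(x) = x³ + αx + β`
and `y² = P'(x) = x³ + α'x + β'` (Wronskian `W = f'g − fg' ≠ 0`, certificate identity
`c²·g·(f³ + α'fg² + β'g³) = P·W²`), the real x-map `R y = f(y)/g(y)` has derivative `R' = W/g²`,
and evaluating the identity at a point `y` of the cell locus `L = {P > 0, W ≠ 0}` gives `g(y) ≠ 0`,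
`c ≠ 0` and the KEY IDENTITY `P'(R y) = P(y)·(R' y)²/c²`, whence the JACOBIAN IDENTITY
`a/√P(y) = ((a/|c|)/√P'(R y))·|R' y|` (the generic `cellMove_jacobian` is imported from the
`ℚ`-line). So on a cell `K = connectedComponentIn L x₀` on which `R` is injective, the
representations `[K, a/√P]` and `[R(K), (a/|c|)/√P']` differ by ONE instance of
`KZ.changeOfVariablesRel` along `Φ(x) = R(x 0)`, `Φ' x = (R'(x 0)) • id`. The one new point of the
line: `Φ` is `ℚ`-semialgebraic because `f/g` is semialgebraic over the field `ℚ̄ ∩ ℝ` of real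
algebraic numbers (`isSemialgebraicFunOn_aeval_div_aeval` over `K = algebraicClosure ℚ ℝ`), hence
over `ℚ` (`IsSemialgebraicFunOn.rat_of_isAlgebraic`, Kontsevich–Zagier §1.1). No definitions.

References: M. Kontsevich, D. Zagier, *Periods* (2001), §1.1, §1.2 rule (2); L. C. Washington,
*Elliptic Curves: Number Theory and Cryptography* (2008), §2.9.
-/

noncomputable section

open Set Filter MeasureTheory Polynomial Topology
open Literature.NumberTheory.Transcendental
open Literature.ModelTheory.ExponentialFields (IsSemialgebraic isSemialgebraic_setOf_eval_ne_zero)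
open Summit.KontsevichZagierPeriods.HermiteRigidity.GenusTwoCycleTransfer
  (det_smul_id_fin_one hasFDerivAt_fin_one)
open Summit.KontsevichZagierPeriods.IsogenyCertificates.LemniscateTwoIsogeny (const_apply_zero_eq)
open Summit.KontsevichZagierPeriods.IsogenyCertificates.XMapPeriodTransferCells (cellMove_jacobian)
open Summit.KontsevichZagierPeriods.IsogenyCertificates.AlgRealPeriodCell.PeriodRep
  (algebraicClosure_isAlgebraic exists_map_eq_of_coeff_isAlgebraic)

namespace Summit.KontsevichZagierPeriods.IsogenyCertificates.AlgRealPeriodCell.TransferCellMove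

/-! ### Pointwise consequences of the certificate identity -/

/-- The certificate identity `c²·g·(f³ + α'fg² + β'g³) = P·W²` evaluated at a real point `y`.
[cite: Washington2008, §2.9] -/
theorem cellMove_eval_identity {α β α' β' : ℝ} {f g : ℝ[X]} {c : ℝ}
    (hI : C (c ^ 2) * g * (f ^ 3 + C α' * f * g ^ 2 + C β' * g ^ 3) =
        (X ^ 3 + C α * X + C β) * (derivative f * g - f * derivative g) ^ 2) (y : ℝ) :
    c ^ 2 * g.eval y * (f.eval y ^ 3 + α' * f.eval y * g.eval y ^ 2 + β' * g.eval y ^ 3) =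
      (y ^ 3 + α * y + β) * (derivative f * g - f * derivative g).eval y ^ 2 := by
  have h := congrArg (fun p : ℝ[X] => p.eval y) hI
  simp only [eval_mul, eval_add, eval_pow, eval_C, eval_X] at h
  exact h

/-- On the cell locus (`P(y) > 0`, `W(y) ≠ 0`): `g(y) ≠ 0`, `c ≠ 0`, and the KEY IDENTITY
`P'(R y) = P(y)·(W y/g(y)²)²/c²` with `R y = f(y)/g(y)`. [cite: Washington2008, §2.9] -/
theorem cellMove_pointwise {α β α' β' : ℝ} {f g : ℝ[X]} {c : ℝ}
    (hI : C (c ^ 2) * g * (f ^ 3 + C α' * f * g ^ 2 + C β' * g ^ 3) =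
        (X ^ 3 + C α * X + C β) * (derivative f * g - f * derivative g) ^ 2)
    {y : ℝ} (hP : 0 < y ^ 3 + α * y + β)
    (hWy : (derivative f * g - f * derivative g).eval y ≠ 0) :
    g.eval y ≠ 0 ∧ c ≠ 0 ∧
      (f.eval y / g.eval y) ^ 3 + α' * (f.eval y / g.eval y) + β' =
        (y ^ 3 + α * y + β) *
          ((derivative f * g - f * derivative g).eval y / g.eval y ^ 2) ^ 2 / c ^ 2 := by
  have h := cellMove_eval_identity hI y
  have hPW : (y ^ 3 + α * y + β) * (derivative f * g - f * derivative g).eval y ^ 2 ≠ 0 :=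
    mul_ne_zero hP.ne' (pow_ne_zero 2 hWy)
  have hG : g.eval y ≠ 0 := by
    intro hG
    rw [hG] at h
    exact hPW (by rw [← h]; ring)
  have hc : c ≠ 0 := by
    intro hc0
    rw [hc0] at h
    exact hPW (by rw [← h]; ring)
  refine ⟨hG, hc, ?_⟩
  rw [eq_div_iff (pow_ne_zero 2 hc)]
  field_simp
  linear_combination h

/-! ### The x-map is a `ℚ`-semialgebraic function -/

/-- **`f/g` read in the coordinate `x 0` of `ℝ¹` is a `ℚ`-semialgebraic function** on every
`ℚ`-semialgebraic set on which `g(x 0) ≠ 0`, for `f g : ℝ[X]` with algebraic coefficients: lift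
`f, g` to `K[X]`, `K = ℚ̄ ∩ ℝ`; the quotient is `K`-semialgebraic on `{g(x 0) ≠ 0}`
(`isSemialgebraicFunOn_aeval_div_aeval`), hence `ℚ`-semialgebraic there
(`IsSemialgebraicFunOn.rat_of_isAlgebraic`), and restricts. [cite: KontsevichZagier2001, §1.1] -/
theorem isSemialgebraicFunOn_eval_div_eval {f g : ℝ[X]} (hf : ∀ n, IsAlgebraic ℚ (f.coeff n))
    (hg : ∀ n, IsAlgebraic ℚ (g.coeff n)) {s : Set (Fin 1 → ℝ)} (hs : IsSemialgebraic ℚ s)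
    (hgs : ∀ x ∈ s, g.eval (x 0) ≠ 0) :
    IsSemialgebraicFunOn ℚ s (fun x => f.eval (x 0) / g.eval (x 0)) := by
  obtain ⟨F, hF⟩ := exists_map_eq_of_coeff_isAlgebraic f hf
  obtain ⟨G, hG⟩ := exists_map_eq_of_coeff_isAlgebraic g hg
  set P : MvPolynomial (Fin 1) ↥(algebraicClosure ℚ ℝ) := Polynomial.aeval (MvPolynomial.X 0) F
    with hPdef
  set Q : MvPolynomial (Fin 1) ↥(algebraicClosure ℚ ℝ) := Polynomial.aeval (MvPolynomial.X 0) G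
    with hQdef
  have hP : ∀ x : Fin 1 → ℝ, MvPolynomial.aeval x P = f.eval (x 0) := by
    intro x
    rw [← hF, Polynomial.eval_map, ← Polynomial.aeval_def]
    simp only [P, ← Polynomial.aeval_algHom_apply, MvPolynomial.aeval_X]
  have hQ : ∀ x : Fin 1 → ℝ, MvPolynomial.aeval x Q = g.eval (x 0) := by
    intro x
    rw [← hG, Polynomial.eval_map, ← Polynomial.aeval_def]
    simp only [Q, ← Polynomial.aeval_algHom_apply, MvPolynomial.aeval_X]
  have hT : IsSemialgebraic (↥(algebraicClosure ℚ ℝ))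
      {x : Fin 1 → ℝ | MvPolynomial.aeval x Q ≠ 0} := isSemialgebraic_setOf_eval_ne_zero (R := ℝ) Q
  have h1 : IsSemialgebraicFunOn (↥(algebraicClosure ℚ ℝ)) {x : Fin 1 → ℝ | MvPolynomial.aeval x Q ≠ 0}
      (fun x => MvPolynomial.aeval x P / MvPolynomial.aeval x Q) :=
    isSemialgebraicFunOn_aeval_div_aeval hT P Q fun _ hx => hx
  have h2 := h1.rat_of_isAlgebraic algebraicClosure_isAlgebraic
  refine (h2.mono (fun x hx => ?_) hs).congr fun x _ => ?_
  · show MvPolynomial.aeval x Q ≠ 0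
    rw [hQ]
    exact hgs x hx
  · simp only [hP, hQ]

/-! ### The registered sub-stub: one cell, one move of rule (2) -/

/-- **Port of the registered stub `stub_cellMove`** (M, one cell = one move of rule (2)) to
real-algebraic data. Along `Φ(x) = R(x 0)` the representations `[cell, a/√P]` and
`[R(cell), (a/|c|)/√P']` differ by a relation: one `KZ.changeOfVariablesRel` instance with
`Φ' x = (W(x 0)/g(x 0)²) • id`, `Φ` `ℚ`-semialgebraic (`f/g` in the coordinate `x 0`, algebraic
coefficients) and injective on the cell by hypothesis, `R(cell)` the image, and Jacobian identity
`a/√P = ((a/|c|)/√(P'∘R))·|R'|` from the certificate identity. The algebraicity hypotheses on the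
coefficients of `f, g` come right after the binders `f g c`. [cite: KontsevichZagier2001, §1.2 rule (2)] -/
theorem stub_cellMove : ∀ (α β α' β' : ℝ) (f g : Polynomial ℝ) (c : ℝ), (∀ n, IsAlgebraic ℚ (f.coeff n)) → (∀ n, IsAlgebraic ℚ (g.coeff n)) → Polynomial.derivative f * g - f * Polynomial.derivative g ≠ 0 → Polynomial.C (c ^ 2) * g * (f ^ 3 + Polynomial.C α' * f * g ^ 2 + Polynomial.C β' * g ^ 3) = (Polynomial.X ^ 3 + Polynomial.C α * Polynomial.X + Polynomial.C β) * (Polynomial.derivative f * g - f * Polynomial.derivative g) ^ 2 → ∀ (R W : ℝ → ℝ) (L : Set ℝ), R = (fun y => f.eval y / g.eval y) → W = (fun y => (Polynomial.derivative f * g - f * Polynomial.derivative g).eval y) → L = {y : ℝ | 0 < y ^ 3 + α * y + β ∧ W y ≠ 0} → ∀ x₀ ∈ L, Set.InjOn R (connectedComponentIn L x₀) → ∀ (a : ℝ) (rI t : Literature.NumberTheory.Transcendental.KZ.IntegralRep 1), rI.domain = {x | x 0 ∈ connectedComponentIn L x₀} → Set.EqOn rI.integrand (fun x => a / Real.sqrt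 (x 0 ^ 3 + α * x 0 + β)) rI.domain → t.domain = {x | x 0 ∈ R '' connectedComponentIn L x₀} → Set.EqOn t.integrand (fun x => a / |c| / Real.sqrt (x 0 ^ 3 + α' * x 0 + β')) t.domain → Literature.NumberTheory.Transcendental.KZ.of rI - Literature.NumberTheory.Transcendental.KZ.of t ∈ Literature.NumberTheory.Transcendental.KZ.relations := by
  intro α β α' β' f g c hf hg _hW hI R W L hR hWd hL x₀ _hx₀ hinj a rI t hrId hrIe htd hte
  -- pointwise readings of the variables `R`, `W` and of the cell
  have hRy : ∀ y, R y = f.eval y / g.eval y := fun y => by rw [hR]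
  have hWy : ∀ y, W y = (derivative f * g - f * derivative g).eval y := fun y => by rw [hWd]
  have hcell : ∀ x ∈ rI.domain, x 0 ∈ connectedComponentIn L x₀ := fun x hx => by
    rwa [hrId] at hx
  have hdom : ∀ x ∈ rI.domain, 0 < x 0 ^ 3 + α * x 0 + β ∧
      (derivative f * g - f * derivative g).eval (x 0) ≠ 0 := by
    intro x hx
    have h := connectedComponentIn_subset L x₀ (hcell x hx)
    rw [hL] at h
    exact ⟨h.1, hWy (x 0) ▸ h.2⟩
  have hG : ∀ x ∈ rI.domain, g.eval (x 0) ≠ 0 := fun x hx =>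
    (cellMove_pointwise hI (hdom x hx).1 (hdom x hx).2).1
  -- the image of the cell is the target domain
  have htdom : t.domain = (fun (x : Fin 1 → ℝ) (_ : Fin 1) => R (x 0)) '' rI.domain := by
    rw [htd, hrId]
    ext X
    simp only [mem_image, mem_setOf_eq]
    constructor
    · rintro ⟨y, hy, hyX⟩
      refine ⟨fun _ => y, hy, ?_⟩
      rw [← const_apply_zero_eq X]
      funext i
      exact hyX
    · rintro ⟨p, hp, rfl⟩
      exact ⟨p 0, hp, rfl⟩
  refine KZ.changeOfVariablesRel_subset_relations
    ⟨1, rI, t, fun x _ => R (x 0),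
      fun x => (W (x 0) / g.eval (x 0) ^ 2) • ContinuousLinearMap.id ℝ (Fin 1 → ℝ),
      ?_, ?_, ?_, htdom, ?_, rfl⟩
  · -- `Φ` is a `ℚ`-semialgebraic map on the cell: it is `f/g` in the coordinate `x 0`
    refine IsSemialgebraicMapOn.of_forall rI.isSemialgebraic_domain fun _ => ?_
    refine (isSemialgebraicFunOn_eval_div_eval hf hg rI.isSemialgebraic_domain hG).congr
      fun x _ => ?_
    beta_reduce
    exact (hRy (x 0)).symm
  · -- derivative `Φ' x = R'(x 0) • id`, `R' = W/g²` (quotient rule)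
    intro x hx
    have hd : HasDerivAt R (W (x 0) / g.eval (x 0) ^ 2) (x 0) := by
      rw [hR, hWy]
      refine ((f.hasDerivAt (x 0)).div (g.hasDerivAt (x 0)) (hG x hx)).congr_deriv ?_
      simp only [eval_sub, eval_mul]
    exact (hasFDerivAt_fin_one R _ x hd).hasFDerivWithinAt
  · -- injectivity on the cell (hypothesis)
    intro p hp q hq h
    have h' : R (p 0) = R (q 0) := congrFun h 0
    have hpq : p 0 = q 0 := hinj (hcell p hp) (hcell q hq) h'
    rw [← const_apply_zero_eq p, ← const_apply_zero_eq q, hpq]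
  · -- the Jacobian identity
    intro x hx
    have hmem : (fun _ : Fin 1 => R (x 0)) ∈ t.domain := htdom ▸ mem_image_of_mem _ hx
    obtain ⟨hGx, hc, hkey⟩ := cellMove_pointwise hI (hdom x hx).1 (hdom x hx).2
    rw [hrIe hx, hte hmem, det_smul_id_fin_one]
    simp only [hRy (x 0), hWy (x 0)]
    exact cellMove_jacobian (hdom x hx).1 (div_ne_zero (hdom x hx).2 (pow_ne_zero 2 hGx)) hc hkey

end Summit.KontsevichZagierPeriods.IsogenyCertificates.AlgRealPeriodCell.TransferCellMove

end
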